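import Summits.KontsevichZagierPeriods.Zeta5Search.Certificates.RecordRayDenominatorsAtlas33Cells
import HarnessLib

/-!
# ζ(5) search — the record ray's DENOMINATORS, X-c2: the remaining FREE-STEP window lemmas (p3 g5)

HONEST FRAMING: systematic search; no irrationality claim unless certified.

OUR work (Summit side; prover seat p3, generation 5).  Continuation of `RecordRayDenominatorsAtlas33Cells` (same shape, see that
file): the windows `(25n/24, 18n/17]⁴` (`RecWindowM52`), `(11n/10, 10n/9]⁴` (`RecWindowM48`), `(10n/9, 9n/8]⁵` (`RecWindowL5M48`)
above `θ = 1`, and the two raised exponents `(41n/10, 25n/6]⁹` (`RecWindowM14` + `RecWindowM14Layer`), `(41n/5, 25n/3]⁷`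
(`RecWindowM8` + `RecWindowM8Layer`).  For a prime of the window the twelve integer parts `⌊cn/p⌋` are pinned, `v_p(N♯)`, `v_p(ρ)`
evaluated, the landed cell theorem supplies `B ≤ v_p(Cas₇)`, and `cell_core` (file V) gives the divisibility of the multiplied
wedge and Q-minor by `p^k`.  Valuation bookkeeping only; no irrationality content.
-/

noncomputable section

open Finset Real Filter Topology

namespace Summit.KontsevichZagierPeriods.Zeta5Search.RecordRay

open Summit.KontsevichZagierPeriods.Zeta5Search.DualSeries
open Summit.KontsevichZagierPeriods.Zeta5Search.DualSeriesDenominators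
open Summit.KontsevichZagierPeriods.Zeta5Search.WedgeDictionary
open Summit.KontsevichZagierPeriods.Zeta5Search.DualSeriesLemma19 (bRecord)
open Summit.KontsevichZagierPeriods.Zeta5Search.CasoratianValuation (casoratian shift)

section Windows

variable {n p : ℕ}

/-- FREE-STEP window `(25/24n, 18/17n]` (table units `1/79560`: `(82875, 84240]`): `RecWindowM52` (`-97 ≤ v_p(Cas₇)`, PROVED in the tree),
`v_p(N♯) = 46`, `v_p(ρ) = 92`, exponent `4`. -/
theorem wFree3 {n p : ℕ} (hn : 47 ≤ n) (hp : p.Prime) (hlo : 82875 * n < 79560 * p) (hhi : 79560 * p ≤ 84240 * n)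
    {zW zV zW' zV' zU zU' : ℤ}
    (hzW : dRec n ^ 3 * sharpNormaliser (bRecord n) * coeffW (bRecord n) = zW)
    (hzV : dRec n ^ 6 * sharpNormaliser (bRecord n) * coeffV (bRecord n) = zV)
    (hzW' : dRec n ^ 3 * sharpNormaliser (bRecord' n) * coeffW (bRecord' n) = zW')
    (hzV' : dRec n ^ 6 * sharpNormaliser (bRecord' n) * coeffV (bRecord' n) = zV')
    (hzU : dRec n * sharpNormaliser (bRecord n) * coeffU (bRecord n) = zU)
    (hzU' : dRec n * sharpNormaliser (bRecord' n) * coeffU (bRecord' n) = zU') :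
    (p : ℤ) ^ 4 ∣ (zW' * zV - zW * zV') ∧
    (p : ℤ) ^ 4 ∣ ((Nat.lcmUpto (41 * n) : ℤ) ^ 5 * (zU * zW') - (Nat.lcmUpto (41 * n) : ℤ) ^ 5 * (zU' * zW)) := by
  have hloN : 25 * n < 24 * p := by omega
  have hhiN' : 17 * p ≤ 18 * n := by omega
  have hn1 : 1 ≤ n := by omega
  have hp41 : p ≤ 41 * n := by omega
  have hnp : n < p := by omega
  have hsq2 : 41 * n + 2 < p ^ 2 := by nlinarith
  have hsq : 41 * n < p ^ 2 := by omega
  have hhiN : 17 * p ≤ 18 * n := hhiN'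
  have hcas : casoratian (bRecord n) 7 ≠ 0 → (-97 : ℤ) ≤ padicValRat p (casoratian (bRecord n) 7) := by
    intro hne
    rw [bRecord_eq_bRec] at hne ⊢
    exact A4WindowM52.recWindowM52_holds n p (by omega) hp (by omega) hhiN hsq2 hne
  have e8 : 8 * n / p = 7 := Nat.div_eq_of_lt_le (by omega) (by omega)
  have e9 : 9 * n / p = 8 := Nat.div_eq_of_lt_le (by omega) (by omega)
  have e10 : 10 * n / p = 9 := Nat.div_eq_of_lt_le (by omega) (by omega)
  have e11 : 11 * n / p = 10 := Nat.div_eq_of_lt_le (by omega) (by omega)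
  have e12 : 12 * n / p = 11 := Nat.div_eq_of_lt_le (by omega) (by omega)
  have e13 : 13 * n / p = 12 := Nat.div_eq_of_lt_le (by omega) (by omega)
  have e14 : 14 * n / p = 13 := Nat.div_eq_of_lt_le (by omega) (by omega)
  have e15 : 15 * n / p = 14 := Nat.div_eq_of_lt_le (by omega) (by omega)
  have e16 : 16 * n / p = 15 := Nat.div_eq_of_lt_le (by omega) (by omega)
  have e17 : 17 * n / p = 16 := Nat.div_eq_of_lt_le (by omega) (by omega)
  have e18 : 18 * n / p = 17 := Nat.div_eq_of_lt_le (by omega) (by omega)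
  have e25 : 25 * n / p = 23 := Nat.div_eq_of_lt_le (by omega) (by omega)
  have hvN : padicValRat p (sharpNormaliser (bRecord n)) = 46 := by
    rw [padicValRat_sharpNormaliser_bRecord hp (by omega), e12, e13, e14, e15, e16]; norm_num
  have hvN' : padicValRat p (sharpNormaliser (bRecord' n)) = 46 := by
    rw [padicValRat_sharpNormaliser_bRecord' hn1 hp hnp (by omega) (by omega), e12, e13, e14, e15, e16]; norm_num
  have hvr : padicValRat p (rhoOf (aRec n)) = 92 := by
    rw [padicValRat_rhoOf_aRec hp (by omega) (by omega), e8, e9, e10, e11, e12, e13, e14, e15, e16, e17, e18, e25]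
    norm_num
  exact cell_core hn1 hp hp41 hsq hvN hvN' hvr hcas (k := 4) (by norm_num) (by norm_num) hzW hzV hzW' hzV' hzU hzU'

/-- FREE-STEP window `(11/10n, 10/9n]` (table units `1/79560`: `(87516, 88400]`): `RecWindowM48` (`-89 ≤ v_p(Cas₇)`, PROVED in the tree),
`v_p(N♯) = 42`, `v_p(ρ) = 87`, exponent `4`. -/
theorem wFree4 {n p : ℕ} (hn : 47 ≤ n) (hp : p.Prime) (hlo : 87516 * n < 79560 * p) (hhi : 79560 * p ≤ 88400 * n)
    {zW zV zW' zV' zU zU' : ℤ}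
    (hzW : dRec n ^ 3 * sharpNormaliser (bRecord n) * coeffW (bRecord n) = zW)
    (hzV : dRec n ^ 6 * sharpNormaliser (bRecord n) * coeffV (bRecord n) = zV)
    (hzW' : dRec n ^ 3 * sharpNormaliser (bRecord' n) * coeffW (bRecord' n) = zW')
    (hzV' : dRec n ^ 6 * sharpNormaliser (bRecord' n) * coeffV (bRecord' n) = zV')
    (hzU : dRec n * sharpNormaliser (bRecord n) * coeffU (bRecord n) = zU)
    (hzU' : dRec n * sharpNormaliser (bRecord' n) * coeffU (bRecord' n) = zU') :
    (p : ℤ) ^ 4 ∣ (zW' * zV - zW * zV') ∧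
    (p : ℤ) ^ 4 ∣ ((Nat.lcmUpto (41 * n) : ℤ) ^ 5 * (zU * zW') - (Nat.lcmUpto (41 * n) : ℤ) ^ 5 * (zU' * zW)) := by
  have hloN : 11 * n < 10 * p := by omega
  have hhiN' : 9 * p ≤ 10 * n := by omega
  have hn1 : 1 ≤ n := by omega
  have hp41 : p ≤ 41 * n := by omega
  have hnp : n < p := by omega
  have hsq2 : 41 * n + 2 < p ^ 2 := by nlinarith
  have hsq : 41 * n < p ^ 2 := by omega
  have hhiN : 9 * p ≤ 10 * n := hhiN'
  have hcas : casoratian (bRecord n) 7 ≠ 0 → (-89 : ℤ) ≤ padicValRat p (casoratian (bRecord n) 7) := by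
    intro hne
    rw [bRecord_eq_bRec] at hne ⊢
    exact A4WindowM48.recWindowM48_holds n p (by omega) hp hloN (by omega) hsq2 hne
  have e8 : 8 * n / p = 7 := Nat.div_eq_of_lt_le (by omega) (by omega)
  have e9 : 9 * n / p = 8 := Nat.div_eq_of_lt_le (by omega) (by omega)
  have e10 : 10 * n / p = 9 := Nat.div_eq_of_lt_le (by omega) (by omega)
  have e11 : 11 * n / p = 9 := Nat.div_eq_of_lt_le (by omega) (by omega)
  have e12 : 12 * n / p = 10 := Nat.div_eq_of_lt_le (by omega) (by omega)
  have e13 : 13 * n / p = 11 := Nat.div_eq_of_lt_le (by omega) (by omega)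
  have e14 : 14 * n / p = 12 := Nat.div_eq_of_lt_le (by omega) (by omega)
  have e15 : 15 * n / p = 13 := Nat.div_eq_of_lt_le (by omega) (by omega)
  have e16 : 16 * n / p = 14 := Nat.div_eq_of_lt_le (by omega) (by omega)
  have e17 : 17 * n / p = 15 := Nat.div_eq_of_lt_le (by omega) (by omega)
  have e18 : 18 * n / p = 16 := Nat.div_eq_of_lt_le (by omega) (by omega)
  have e25 : 25 * n / p = 22 := Nat.div_eq_of_lt_le (by omega) (by omega)
  have hvN : padicValRat p (sharpNormaliser (bRecord n)) = 42 := by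
    rw [padicValRat_sharpNormaliser_bRecord hp (by omega), e12, e13, e14, e15, e16]; norm_num
  have hvN' : padicValRat p (sharpNormaliser (bRecord' n)) = 42 := by
    rw [padicValRat_sharpNormaliser_bRecord' hn1 hp hnp (by omega) (by omega), e12, e13, e14, e15, e16]; norm_num
  have hvr : padicValRat p (rhoOf (aRec n)) = 87 := by
    rw [padicValRat_rhoOf_aRec hp (by omega) (by omega), e8, e9, e10, e11, e12, e13, e14, e15, e16, e17, e18, e25]
    norm_num
  exact cell_core hn1 hp hp41 hsq hvN hvN' hvr hcas (k := 4) (by norm_num) (by norm_num) hzW hzV hzW' hzV' hzU hzU'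

/-- FREE-STEP window `(10/9n, 9/8n]` (table units `1/79560`: `(88400, 89505]`): `RecWindowL5M48` (`-88 ≤ v_p(Cas₇)`, PROVED in the tree),
`v_p(N♯) = 42`, `v_p(ρ) = 85`, exponent `5`. -/
theorem wFree5 {n p : ℕ} (hn : 47 ≤ n) (hp : p.Prime) (hlo : 88400 * n < 79560 * p) (hhi : 79560 * p ≤ 89505 * n)
    {zW zV zW' zV' zU zU' : ℤ}
    (hzW : dRec n ^ 3 * sharpNormaliser (bRecord n) * coeffW (bRecord n) = zW)
    (hzV : dRec n ^ 6 * sharpNormaliser (bRecord n) * coeffV (bRecord n) = zV)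
    (hzW' : dRec n ^ 3 * sharpNormaliser (bRecord' n) * coeffW (bRecord' n) = zW')
    (hzV' : dRec n ^ 6 * sharpNormaliser (bRecord' n) * coeffV (bRecord' n) = zV')
    (hzU : dRec n * sharpNormaliser (bRecord n) * coeffU (bRecord n) = zU)
    (hzU' : dRec n * sharpNormaliser (bRecord' n) * coeffU (bRecord' n) = zU') :
    (p : ℤ) ^ 5 ∣ (zW' * zV - zW * zV') ∧
    (p : ℤ) ^ 5 ∣ ((Nat.lcmUpto (41 * n) : ℤ) ^ 5 * (zU * zW') - (Nat.lcmUpto (41 * n) : ℤ) ^ 5 * (zU' * zW)) := by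
  have hloN : 10 * n < 9 * p := by omega
  have hhiN' : 8 * p ≤ 9 * n := by omega
  have hn1 : 1 ≤ n := by omega
  have hp41 : p ≤ 41 * n := by omega
  have hnp : n < p := by omega
  have hsq2 : 41 * n + 2 < p ^ 2 := by nlinarith
  have hsq : 41 * n < p ^ 2 := by omega
  have hhiN : 8 * p ≤ 9 * n := hhiN'
  have hcas : casoratian (bRecord n) 7 ≠ 0 → (-88 : ℤ) ≤ padicValRat p (casoratian (bRecord n) 7) := by
    intro hne
    rw [bRecord_eq_bRec] at hne ⊢
    exact L5ShapeM48.recWindowL5M48_holds n p (by omega) hp hloN hhiN hsq2 hne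
  have e8 : 8 * n / p = 7 := Nat.div_eq_of_lt_le (by omega) (by omega)
  have e9 : 9 * n / p = 8 := Nat.div_eq_of_lt_le (by omega) (by omega)
  have e10 : 10 * n / p = 8 := Nat.div_eq_of_lt_le (by omega) (by omega)
  have e11 : 11 * n / p = 9 := Nat.div_eq_of_lt_le (by omega) (by omega)
  have e12 : 12 * n / p = 10 := Nat.div_eq_of_lt_le (by omega) (by omega)
  have e13 : 13 * n / p = 11 := Nat.div_eq_of_lt_le (by omega) (by omega)
  have e14 : 14 * n / p = 12 := Nat.div_eq_of_lt_le (by omega) (by omega)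
  have e15 : 15 * n / p = 13 := Nat.div_eq_of_lt_le (by omega) (by omega)
  have e16 : 16 * n / p = 14 := Nat.div_eq_of_lt_le (by omega) (by omega)
  have e17 : 17 * n / p = 15 := Nat.div_eq_of_lt_le (by omega) (by omega)
  have e18 : 18 * n / p = 16 := Nat.div_eq_of_lt_le (by omega) (by omega)
  have e25 : 25 * n / p = 22 := Nat.div_eq_of_lt_le (by omega) (by omega)
  have hvN : padicValRat p (sharpNormaliser (bRecord n)) = 42 := by
    rw [padicValRat_sharpNormaliser_bRecord hp (by omega), e12, e13, e14, e15, e16]; norm_num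
  have hvN' : padicValRat p (sharpNormaliser (bRecord' n)) = 42 := by
    rw [padicValRat_sharpNormaliser_bRecord' hn1 hp hnp (by omega) (by omega), e12, e13, e14, e15, e16]; norm_num
  have hvr : padicValRat p (rhoOf (aRec n)) = 85 := by
    rw [padicValRat_rhoOf_aRec hp (by omega) (by omega), e8, e9, e10, e11, e12, e13, e14, e15, e16, e17, e18, e25]
    norm_num
  exact cell_core hn1 hp hp41 hsq hvN hvN' hvr hcas (k := 5) (by norm_num) (by norm_num) hzW hzV hzW' hzV' hzU hzU'

/-- FREE-STEP window `(41/10n, 25/6n]` (table units `1/79560`: `(326196, 331500]`): `RecWindowM14` + `RecWindowM14Layer` (`-22 ≤ v_p(Cas₇)`, PROVED in the tree),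
`v_p(N♯) = 11`, `v_p(ρ) = 18`, exponent `9`. -/
theorem wFree6 {n p : ℕ} (hn : 47 ≤ n) (hp : p.Prime) (hlo : 326196 * n < 79560 * p) (hhi : 79560 * p ≤ 331500 * n)
    {zW zV zW' zV' zU zU' : ℤ}
    (hzW : dRec n ^ 3 * sharpNormaliser (bRecord n) * coeffW (bRecord n) = zW)
    (hzV : dRec n ^ 6 * sharpNormaliser (bRecord n) * coeffV (bRecord n) = zV)
    (hzW' : dRec n ^ 3 * sharpNormaliser (bRecord' n) * coeffW (bRecord' n) = zW')
    (hzV' : dRec n ^ 6 * sharpNormaliser (bRecord' n) * coeffV (bRecord' n) = zV')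
    (hzU : dRec n * sharpNormaliser (bRecord n) * coeffU (bRecord n) = zU)
    (hzU' : dRec n * sharpNormaliser (bRecord' n) * coeffU (bRecord' n) = zU') :
    (p : ℤ) ^ 9 ∣ (zW' * zV - zW * zV') ∧
    (p : ℤ) ^ 9 ∣ ((Nat.lcmUpto (41 * n) : ℤ) ^ 5 * (zU * zW') - (Nat.lcmUpto (41 * n) : ℤ) ^ 5 * (zU' * zW)) := by
  have hloN : 41 * n < 10 * p := by omega
  have hhiN' : 6 * p ≤ 25 * n := by omega
  have hn1 : 1 ≤ n := by omega
  have hp41 : p ≤ 41 * n := by omega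
  have hnp : n < p := by omega
  have hsq : 41 * n < p ^ 2 := by nlinarith
  have hhiN : 6 * p < 25 * n := lt_mul_of_prime hp hnp (show 25 < p by omega) (by norm_num) hn1 hhiN'
  have hcas : casoratian (bRecord n) 7 ≠ 0 → (-22 : ℤ) ≤ padicValRat p (casoratian (bRecord n) 7) := by
    intro hne
    rw [bRecord_eq_bRec] at hne ⊢
    rcases le_or_gt (10 * p) (41 * n + 2) with hlay | hlay
    · exact ZeroWindowM14Layer.recWindowM14Layer_holds n p (by omega) hp hloN hlay hne
    · exact ZeroWindowM14.recWindowM14_holds n p (by omega) hp (by omega) hhiN hne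
  have e8 : 8 * n / p = 1 := Nat.div_eq_of_lt_le (by omega) (by omega)
  have e9 : 9 * n / p = 2 := Nat.div_eq_of_lt_le (by omega) (by omega)
  have e10 : 10 * n / p = 2 := Nat.div_eq_of_lt_le (by omega) (by omega)
  have e11 : 11 * n / p = 2 := Nat.div_eq_of_lt_le (by omega) (by omega)
  have e12 : 12 * n / p = 2 := Nat.div_eq_of_lt_le (by omega) (by omega)
  have e13 : 13 * n / p = 3 := Nat.div_eq_of_lt_le (by omega) (by omega)
  have e14 : 14 * n / p = 3 := Nat.div_eq_of_lt_le (by omega) (by omega)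
  have e15 : 15 * n / p = 3 := Nat.div_eq_of_lt_le (by omega) (by omega)
  have e16 : 16 * n / p = 3 := Nat.div_eq_of_lt_le (by omega) (by omega)
  have e17 : 17 * n / p = 4 := Nat.div_eq_of_lt_le (by omega) (by omega)
  have e18 : 18 * n / p = 4 := Nat.div_eq_of_lt_le (by omega) (by omega)
  have e25 : 25 * n / p = 6 := Nat.div_eq_of_lt_le (by omega) (by omega)
  have hvN : padicValRat p (sharpNormaliser (bRecord n)) = 11 := by
    rw [padicValRat_sharpNormaliser_bRecord hp (by omega), e12, e13, e14, e15, e16]; norm_num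
  have hvN' : padicValRat p (sharpNormaliser (bRecord' n)) = 11 := by
    rw [padicValRat_sharpNormaliser_bRecord' hn1 hp hnp (by omega) (by omega), e12, e13, e14, e15, e16]; norm_num
  have hvr : padicValRat p (rhoOf (aRec n)) = 18 := by
    rw [padicValRat_rhoOf_aRec hp (by omega) (by omega), e8, e9, e10, e11, e12, e13, e14, e15, e16, e17, e18, e25]
    norm_num
  exact cell_core hn1 hp hp41 hsq hvN hvN' hvr hcas (k := 9) (by norm_num) (by norm_num) hzW hzV hzW' hzV' hzU hzU'

/-- FREE-STEP window `(41/5n, 25/3n]` (table units `1/79560`: `(652392, 663000]`): `RecWindowM8` + `RecWindowM8Layer` (`-10 ≤ v_p(Cas₇)`, PROVED in the tree),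
`v_p(N♯) = 4`, `v_p(ρ) = 7`, exponent `7`. -/
theorem wFree7 {n p : ℕ} (hn : 47 ≤ n) (hp : p.Prime) (hlo : 652392 * n < 79560 * p) (hhi : 79560 * p ≤ 663000 * n)
    {zW zV zW' zV' zU zU' : ℤ}
    (hzW : dRec n ^ 3 * sharpNormaliser (bRecord n) * coeffW (bRecord n) = zW)
    (hzV : dRec n ^ 6 * sharpNormaliser (bRecord n) * coeffV (bRecord n) = zV)
    (hzW' : dRec n ^ 3 * sharpNormaliser (bRecord' n) * coeffW (bRecord' n) = zW')
    (hzV' : dRec n ^ 6 * sharpNormaliser (bRecord' n) * coeffV (bRecord' n) = zV')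
    (hzU : dRec n * sharpNormaliser (bRecord n) * coeffU (bRecord n) = zU)
    (hzU' : dRec n * sharpNormaliser (bRecord' n) * coeffU (bRecord' n) = zU') :
    (p : ℤ) ^ 7 ∣ (zW' * zV - zW * zV') ∧
    (p : ℤ) ^ 7 ∣ ((Nat.lcmUpto (41 * n) : ℤ) ^ 5 * (zU * zW') - (Nat.lcmUpto (41 * n) : ℤ) ^ 5 * (zU' * zW)) := by
  have hloN : 41 * n < 5 * p := by omega
  have hhiN' : 3 * p ≤ 25 * n := by omega
  have hn1 : 1 ≤ n := by omega
  have hp41 : p ≤ 41 * n := by omega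
  have hnp : n < p := by omega
  have hsq : 41 * n < p ^ 2 := by nlinarith
  have hhiN : 3 * p < 25 * n := lt_mul_of_prime hp hnp (show 25 < p by omega) (by norm_num) hn1 hhiN'
  have hcas : casoratian (bRecord n) 7 ≠ 0 → (-10 : ℤ) ≤ padicValRat p (casoratian (bRecord n) 7) := by
    intro hne
    rw [bRecord_eq_bRec] at hne ⊢
    rcases le_or_gt (5 * p) (41 * n + 2) with hlay | hlay
    · exact ZeroWindowM8Layer.recWindowM8Layer_holds n p (by omega) hp hloN hlay hne
    · exact ZeroWindowM8.recWindowM8_holds n p (by omega) hp (by omega) hhiN hne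
  have e8 : 8 * n / p = 0 := Nat.div_eq_of_lt_le (by omega) (by omega)
  have e9 : 9 * n / p = 1 := Nat.div_eq_of_lt_le (by omega) (by omega)
  have e10 : 10 * n / p = 1 := Nat.div_eq_of_lt_le (by omega) (by omega)
  have e11 : 11 * n / p = 1 := Nat.div_eq_of_lt_le (by omega) (by omega)
  have e12 : 12 * n / p = 1 := Nat.div_eq_of_lt_le (by omega) (by omega)
  have e13 : 13 * n / p = 1 := Nat.div_eq_of_lt_le (by omega) (by omega)
  have e14 : 14 * n / p = 1 := Nat.div_eq_of_lt_le (by omega) (by omega)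
  have e15 : 15 * n / p = 1 := Nat.div_eq_of_lt_le (by omega) (by omega)
  have e16 : 16 * n / p = 1 := Nat.div_eq_of_lt_le (by omega) (by omega)
  have e17 : 17 * n / p = 2 := Nat.div_eq_of_lt_le (by omega) (by omega)
  have e18 : 18 * n / p = 2 := Nat.div_eq_of_lt_le (by omega) (by omega)
  have e25 : 25 * n / p = 3 := Nat.div_eq_of_lt_le (by omega) (by omega)
  have hvN : padicValRat p (sharpNormaliser (bRecord n)) = 4 := by
    rw [padicValRat_sharpNormaliser_bRecord hp (by omega), e12, e13, e14, e15, e16]; norm_num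
  have hvN' : padicValRat p (sharpNormaliser (bRecord' n)) = 4 := by
    rw [padicValRat_sharpNormaliser_bRecord' hn1 hp hnp (by omega) (by omega), e12, e13, e14, e15, e16]; norm_num
  have hvr : padicValRat p (rhoOf (aRec n)) = 7 := by
    rw [padicValRat_rhoOf_aRec hp (by omega) (by omega), e8, e9, e10, e11, e12, e13, e14, e15, e16, e17, e18, e25]
    norm_num
  exact cell_core hn1 hp hp41 hsq hvN hvN' hvr hcas (k := 7) (by norm_num) (by norm_num) hzW hzV hzW' hzV' hzU hzU'

end Windows

end Summit.KontsevichZagierPeriods.Zeta5Search.RecordRay
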